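import Literature.Analysis.FluidPDE.KNSSTypeIIZoomIn
import HarnessLib

/-!
# Route PlaneEnergyCeiling · crux `BoundedPlanarEnergyRegularity` — zoom stub, step 2:
# the uniform Lipschitz bound up to the final time, finite-energy version

Helper file for the crux item stmt-NavierStokesRegularity-16921 (`BoundedPlanarEnergyRegularity`),
serving the zoom stub `stub_planarEnergyZoom` (= support item stmt-NavierStokesRegularity-16858) of
its line `birth`: the finite-energy twin of `lipschitz_up_to_final_time`
(`Literature/Analysis/FluidPDE/KNSSTypeIIZoomIn.lean`, KNSS 2009, Lemma 6.1 and the proof of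
Thm. 6.1, arXiv:0709.3599 p. 12), in which the scale-invariant hypothesis `|x'| ‖V‖ ≤ C` of the
axisymmetric setting is replaced by square-integrability of the slices, `V(s) ∈ L²(ℝ³)` for
`s ∈ (A, B)` (the property supplied by `lipschitz_of_memLp_two`). Statement: if a constant `K`
bounds the Lipschitz modulus on `[1/2, 1) × ℝ³` of every bounded weak solution on `ℝ³ × (0,1)`
that is continuous on the open slab, bounded by `2` and has square-integrable slices, then every
classical solution `(V, P)` (`ν = 1`) on `(A, B) × ℝ³`, `A ≤ −2 < 0 < B`, with `‖V‖ ≤ 2` on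
`(A, 0]` and `V(s) ∈ L²` for `s ∈ (A, B)`, satisfies
`‖V(t, x) − V(s, y)‖ ≤ max K 8 · (|t − s| + ‖x − y‖)` for `s, t ∈ [A + 1, 0]`. The proof is that
of the template verbatim (translated unit windows, continuity at `s = 0`, the bound `2` for
far-apart times); square-integrability of slices is invariant under time translation.

References: Koch–Nadirashvili–Seregin–Šverák, Acta Math. 203 (2009) = arXiv:0709.3599, §6,
Lemma 6.1 and the proof of Thm. 6.1 (pp. 11–12). [KochNadirashviliSereginSverak2009]
-/

noncomputable section

-- single-conjunct summit: `Summit.<Summit>.<Problem>` repeats the name by the D-0017 layout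
set_option linter.dupNamespace false

namespace Summit.NavierStokesRegularity.NavierStokesRegularity.Theorems.BoundedPlanarEnergyRegularity

open MeasureTheory Set Function Filter Topology TopologicalSpace Metric
open scoped NNReal
open Literature.Analysis.FluidPDE

-- adapted from Literature/Analysis/FluidPDE/KNSSTypeIIZoomIn.lean (lipschitz_up_to_final_time)
/-- **From unit windows to `[A + 1, 0]`, up to the final time (finite-energy version).** Suppose
`K` bounds the space–time Lipschitz modulus on `[1/2, 1) × ℝ³` of every bounded weak solution on
`ℝ³ × (0, 1)` (`ν = 1`) that is continuous on the open slab, bounded by `2` and has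
square-integrable slices. Let `(V, P)` be a classical solution of the unforced system (`ν = 1`) on
`(A, B) × ℝ³` with `A ≤ −2 < 0 < B`, `‖V‖ ≤ 2` on `(A, 0] × ℝ³` and `V(s) ∈ L²(ℝ³)` for
`s ∈ (A, B)`. Then `‖V(t, x) − V(s, y)‖ ≤ max K 8 · (|t − s| + ‖x − y‖)` for all
`s, t ∈ [A + 1, 0]`, `x, y` (KNSS 2009, Lemma 6.1 and the proof of Thm. 6.1: the equicontinuity of
the rescaled sequence, uniform up to `s = 0`). -/
theorem lipschitz_up_to_final_time_of_memLp :
    ∀ (K : ℝ), (∀ ⦃w : ℝ → EuclideanSpace ℝ (Fin 3) → EuclideanSpace ℝ (Fin 3)⦄,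
      Literature.Analysis.FluidPDE.IsBoundedWeakNSSolutionOn (Set.Ioo 0 1) isOpen_Ioo 1 w →
      ContinuousOn (Function.uncurry w) (Set.Ioo (0 : ℝ) 1 ×ˢ Set.univ) →
      (∀ t ∈ Set.Ioo (0 : ℝ) 1, ∀ x, ‖w t x‖ ≤ 2) →
      (∀ t ∈ Set.Ioo (0 : ℝ) 1, MeasureTheory.MemLp (w t) 2 MeasureTheory.volume) →
      ∀ s ∈ Set.Ico (1 / 2 : ℝ) 1, ∀ t ∈ Set.Ico (1 / 2 : ℝ) 1, ∀ x y : EuclideanSpace ℝ (Fin 3),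
        ‖w t x - w s y‖ ≤ K * (|t - s| + ‖x - y‖)) →
    ∀ (A B : ℝ), A ≤ -2 → 0 < B →
    ∀ (V : ℝ → EuclideanSpace ℝ (Fin 3) → EuclideanSpace ℝ (Fin 3)) (P : ℝ → EuclideanSpace ℝ (Fin 3) → ℝ),
      Literature.Analysis.FluidPDE.IsClassicalNSSolutionOn (Set.Ioo A B) 1 0 V P →
      (∀ s ∈ Set.Ioc A 0, ∀ y, ‖V s y‖ ≤ 2) →
      (∀ s ∈ Set.Ioo A B, MeasureTheory.MemLp (V s) 2 MeasureTheory.volume) →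
      ∀ s ∈ Set.Icc (A + 1) 0, ∀ t ∈ Set.Icc (A + 1) 0, ∀ x y : EuclideanSpace ℝ (Fin 3),
        ‖V t x - V s y‖ ≤ max K 8 * (|t - s| + ‖x - y‖) := by
  intro K hKprop A B hA hB V P hV hbd hL2
  -- (i) the window bound, translated: times in `[σ - 1/2, σ)`, `σ ∈ [A + 1, 0]`
  have hwin : ∀ σ ∈ Icc (A + 1) 0, ∀ r₁ ∈ Ico (σ - 1 / 2) σ, ∀ r₂ ∈ Ico (σ - 1 / 2) σ,
      ∀ x y : (EuclideanSpace ℝ (Fin 3)), ‖V r₂ x - V r₁ y‖ ≤ K * (|r₂ - r₁| + ‖x - y‖) := by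
    intro σ hσ r₁ hr₁ r₂ hr₂ x y
    set w : ℝ → (EuclideanSpace ℝ (Fin 3)) → (EuclideanSpace ℝ (Fin 3)) := fun τ => V (τ + (σ - 1)) with hw_def
    have hmem : ∀ τ ∈ Ioo (0 : ℝ) 1, τ + (σ - 1) ∈ Ioo A B := fun τ hτ =>
      ⟨by linarith [hτ.1, hσ.1], by linarith [hτ.2, hσ.2]⟩
    have hw : IsClassicalNSSolutionOn (Ioo 0 1) 1 (fun τ => (0 : ℝ → (EuclideanSpace ℝ (Fin 3)) → (EuclideanSpace ℝ (Fin 3))) (τ + (σ - 1))) w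
        (fun τ => P (τ + (σ - 1))) :=
      (hV.comp_add_right (σ - 1)).mono (fun τ hτ => hmem τ hτ) (uniqueDiffOn_Ioo 0 1)
    have h0 : (fun τ : ℝ => (0 : ℝ → (EuclideanSpace ℝ (Fin 3)) → (EuclideanSpace ℝ (Fin 3))) (τ + (σ - 1))) = 0 := by
      funext τ; rfl
    have hw' : IsClassicalNSSolutionOn (Ioo 0 1) 1 0 w (fun τ => P (τ + (σ - 1))) := by
      rw [h0] at hw; exact hw
    have hwbd : ∀ τ ∈ Ioo (0 : ℝ) 1, ∀ z, ‖w τ z‖ ≤ 2 := fun τ hτ z =>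
      hbd _ ⟨(hmem τ hτ).1, by linarith [hτ.2, hσ.2]⟩ z
    have hweak := hw'.isBoundedWeakNSSolutionOn ⟨2, hwbd⟩
    have hwc : ContinuousOn (uncurry w) (Ioo (0 : ℝ) 1 ×ˢ univ) := hw'.smooth_velocity.continuousOn
    have hwL2 : ∀ τ ∈ Ioo (0 : ℝ) 1, MemLp (w τ) 2 volume := fun τ hτ =>
      hL2 _ (hmem τ hτ)
    have key := hKprop hweak hwc hwbd hwL2 (r₁ - (σ - 1)) ⟨by linarith [hr₁.1], by linarith [hr₁.2]⟩
      (r₂ - (σ - 1)) ⟨by linarith [hr₂.1], by linarith [hr₂.2]⟩ x y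
    simp only [hw_def, sub_add_cancel] at key
    rwa [show r₂ - (σ - 1) - (r₁ - (σ - 1)) = r₂ - r₁ by ring] at key
  -- (ii) pairs of times `< 0` at distance `< 1/2`
  have hneg : ∀ s ∈ Ico (A + 1) 0, ∀ t ∈ Ico (A + 1) 0, |t - s| < 1 / 2 → ∀ x y : (EuclideanSpace ℝ (Fin 3)),
      ‖V t x - V s y‖ ≤ K * (|t - s| + ‖x - y‖) := by
    intro s hs t ht hts x y
    have hts' := abs_lt.1 hts
    set σ : ℝ := min 0 (min s t + 1 / 2) with hσ
    have hσA : σ ∈ Icc (A + 1) 0 := by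
      refine ⟨le_min (by linarith) ?_, min_le_left _ _⟩
      have := min_le_min hs.1 ht.1
      rw [min_self] at this
      linarith
    refine hwin σ hσA s ⟨?_, ?_⟩ t ⟨?_, ?_⟩ x y
    · have h1 : σ ≤ min s t + 1 / 2 := min_le_right _ _
      have h2 : min s t ≤ s := min_le_left _ _
      linarith
    · refine lt_min hs.2 ?_
      rcases le_total s t with h | h
      · rw [min_eq_left h]; linarith
      · rw [min_eq_right h]; linarith
    · have h1 : σ ≤ min s t + 1 / 2 := min_le_right _ _
      have h2 : min s t ≤ t := min_le_right _ _
      linarith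
    · refine lt_min ht.2 ?_
      rcases le_total s t with h | h
      · rw [min_eq_left h]; linarith
      · rw [min_eq_right h]; linarith
  -- (iii) up to the final time, by continuity of `V`
  have hcontV : ContinuousOn (uncurry V) (Ioo A B ×ˢ univ) := hV.smooth_velocity.continuousOn
  have hopen : IsOpen (Ioo A B ×ˢ (univ : Set (EuclideanSpace ℝ (Fin 3)))) := isOpen_Ioo.prod isOpen_univ
  have htend : ∀ r ∈ Icc (A + 1) 0, ∀ z : (EuclideanSpace ℝ (Fin 3)),
      Tendsto (fun n : ℕ => V (min r (-(1 / ((n : ℝ) + 1)))) z) atTop (𝓝 (V r z)) := by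
    intro r hr z
    have hseq : Tendsto (fun n : ℕ => min r (-(1 / ((n : ℝ) + 1)))) atTop (𝓝 r) := by
      have h0 : Tendsto (fun n : ℕ => -(1 / ((n : ℝ) + 1))) atTop (𝓝 0) := by
        simpa using (tendsto_one_div_add_atTop_nhds_zero_nat (𝕜 := ℝ)).neg
      have := (tendsto_const_nhds (x := r)).min h0
      rwa [min_eq_left hr.2] at this
    have hcat : ContinuousAt (uncurry V) (r, z) :=
      hcontV.continuousAt (hopen.mem_nhds ⟨⟨by linarith [hr.1], hr.2.trans_lt hB⟩, mem_univ z⟩)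
    exact hcat.tendsto.comp (hseq.prodMk_nhds tendsto_const_nhds)
  have hclose : ∀ s ∈ Icc (A + 1) 0, ∀ t ∈ Icc (A + 1) 0, |t - s| < 1 / 2 → ∀ x y : (EuclideanSpace ℝ (Fin 3)),
      ‖V t x - V s y‖ ≤ K * (|t - s| + ‖x - y‖) := by
    intro s hs t ht hts x y
    set sq : ℕ → ℝ := fun n => min s (-(1 / ((n : ℝ) + 1))) with hsq
    set tq : ℕ → ℝ := fun n => min t (-(1 / ((n : ℝ) + 1))) with htq
    have hneg1 : ∀ n : ℕ, -(1 / ((n : ℝ) + 1)) < 0 := fun n =>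
      neg_neg_of_pos (by positivity)
    have hge1 : ∀ n : ℕ, -1 ≤ -(1 / ((n : ℝ) + 1)) := fun n => by
      rw [neg_le_neg_iff, div_le_one (by positivity)]
      linarith [n.cast_nonneg (α := ℝ)]
    have hmemq : ∀ r ∈ Icc (A + 1) 0, ∀ n : ℕ, min r (-(1 / ((n : ℝ) + 1))) ∈ Ico (A + 1) 0 :=
      fun r hr n => ⟨le_min hr.1 (by linarith [hge1 n]), (min_le_right _ _).trans_lt (hneg1 n)⟩
    have hdist : ∀ n, |tq n - sq n| ≤ |t - s| := fun n => by
      have := abs_min_sub_min_le_max t (-(1 / ((n : ℝ) + 1))) s (-(1 / ((n : ℝ) + 1)))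
      rwa [sub_self, abs_zero, max_eq_left (abs_nonneg _)] at this
    have hn : ∀ n, ‖V (tq n) x - V (sq n) y‖ ≤ K * (|tq n - sq n| + ‖x - y‖) := fun n =>
      hneg (sq n) (hmemq s hs n) (tq n) (hmemq t ht n) ((hdist n).trans_lt hts) x y
    have hlhs : Tendsto (fun n => ‖V (tq n) x - V (sq n) y‖) atTop (𝓝 ‖V t x - V s y‖) :=
      ((htend t ht x).sub (htend s hs y)).norm
    have hrhs : Tendsto (fun n => K * (|tq n - sq n| + ‖x - y‖)) atTop
        (𝓝 (K * (|t - s| + ‖x - y‖))) := by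
      have h1 : Tendsto tq atTop (𝓝 t) := by
        have := htend t ht x
        have h0 : Tendsto (fun n : ℕ => -(1 / ((n : ℝ) + 1))) atTop (𝓝 0) := by
          simpa using (tendsto_one_div_add_atTop_nhds_zero_nat (𝕜 := ℝ)).neg
        have := (tendsto_const_nhds (x := t)).min h0
        rwa [min_eq_left ht.2] at this
      have h2 : Tendsto sq atTop (𝓝 s) := by
        have h0 : Tendsto (fun n : ℕ => -(1 / ((n : ℝ) + 1))) atTop (𝓝 0) := by
          simpa using (tendsto_one_div_add_atTop_nhds_zero_nat (𝕜 := ℝ)).neg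
        have := (tendsto_const_nhds (x := s)).min h0
        rwa [min_eq_left hs.2] at this
      exact (((continuous_abs.tendsto _).comp (h1.sub h2)).add tendsto_const_nhds).const_mul K
    exact le_of_tendsto_of_tendsto' hlhs hrhs hn
  -- (iv) far-apart times by the bound `2`
  intro s hs t ht x y
  have hKle : K ≤ max K 8 := le_max_left _ _
  have hsum0 : 0 ≤ |t - s| + ‖x - y‖ := by positivity
  by_cases hts : |t - s| < 1 / 2
  · exact (hclose s hs t ht hts x y).trans (mul_le_mul_of_nonneg_right hKle hsum0)
  · have h1 : ‖V t x‖ ≤ 2 := hbd t ⟨by linarith [ht.1], ht.2⟩ x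
    have h2 : ‖V s y‖ ≤ 2 := hbd s ⟨by linarith [hs.1], hs.2⟩ y
    have h3 : 1 / 2 ≤ |t - s| := not_lt.1 hts
    calc ‖V t x - V s y‖ ≤ ‖V t x‖ + ‖V s y‖ := norm_sub_le _ _
      _ ≤ 8 * (|t - s| + ‖x - y‖) := by nlinarith [norm_nonneg (x - y)]
      _ ≤ max K 8 * (|t - s| + ‖x - y‖) := mul_le_mul_of_nonneg_right (le_max_right _ _) hsum0


end Summit.NavierStokesRegularity.NavierStokesRegularity.Theorems.BoundedPlanarEnergyRegularity

end
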